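import Literature.NumberTheory.Automorphic.LieGraphCenter
import HarnessLib

/-!
# The Lie-algebra isomorphism theorem, VI: `D` is the graph of an isomorphism `ψ : 𝔤₁ ≅ 𝔤₂`
(trunk T-AUTOMORPHIC, G25 AutomorphicL; Humphreys 14.2 / 18.4 for `Lie(G)` of two reductive groups with
the same root datum in characteristic `0`; DAG of `chevalley_isomorphism`)

Conclusion of `LieGraphSetup/Core/Swap/Commutant/Center.lean`. For connected reductive `(G₁, T₁)`,
`(G₂, T₂)` with the same root datum `P` over an algebraically closed field of characteristic `0` and a
regular coweight `y`, the graph subalgebra `D ≤ 𝔤₁ × 𝔤₂` has both projections surjective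
(`exists_mem_fst_eq`, `exists_mem_snd_eq`: they contain `Lie(Tⱼ)` and every root line `k eⱼ_γ`, which
span `𝔤ⱼ`) and injective (`eq_of_fst_eq`, `eq_of_snd_eq`, part V). Hence:

* **`psi`** — the linear isomorphism `ψ : Lie(G₁) ≃ₗ[k] Lie(G₂)` whose graph is `D` (`mem_graph_psi`,
  `psi_eq_of_mem`), **a homomorphism of Lie algebras** (`psi_lie`: `ψ [A, A'] = [ψ A, ψ A']`), with
  `ψ|Lie(T₁) = θ` (`psi_torus`), `ψ (h¹_γ) = h²_γ` (`psi_rootH`), `ψ (e¹_i) = e²_i`, `ψ (f¹_i) = f²_i`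
  for the simple roots (`psi_rootE`, `psi_rootF`);
* **equivariance** `ψ (t A t⁻¹) = f_T(t) ψ(A) f_T(t)⁻¹` for `t ∈ T₁` (`psi_conj`, from the
  `σ_t`-stability of `D`), whence **`ψ (𝔤₁_x) ⊆ 𝔤₂_x`** for every weight `x` (`psi_mem_lieWeightSpace`).

This is the Lie-algebra isomorphism theorem in the form needed for the group-level graph argument
proving `chevalley_isomorphism_abstract` (Springer 9.6.2, step 1).

## References

* [Humphreys1972] J. E. Humphreys, *Introduction to Lie Algebras and Representation Theory*,
  GTM 9, Springer (1972), §14.2, §18.4.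
* [SpringerLAG1998] T. A. Springer, *Linear Algebraic Groups*, 2nd ed. (1998), 9.6.2.
-/

noncomputable section

open scoped MatrixGroups IsMulCommutative
open Set

attribute [local instance 100] LieRing.ofAssociativeRing

namespace Literature.NumberTheory.Automorphic

namespace LieGraph

variable {k : Type*} [Field k]
variable {n₁ n₂ : Type*} [Fintype n₁] [DecidableEq n₁] [Fintype n₂] [DecidableEq n₂]
variable {ι X Y : Type*} [AddCommGroup X] [AddCommGroup Y]
variable {G₁ T₁ : Subgroup (GL n₁ k)} {G₂ T₂ : Subgroup (GL n₂ k)}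
  [IsMulCommutative ↥T₁] [IsMulCommutative ↥T₂]
variable {P : RootPairing ι ℤ X Y}
variable {eX₁ : Additive ↥(characterLattice T₁) ≃+ X} {eY₁ : Additive ↥(cocharacterLattice T₁) ≃+ Y}
variable {eX₂ : Additive ↥(characterLattice T₂) ≃+ X} {eY₂ : Additive ↥(cocharacterLattice T₂) ≃+ Y}

section Iso

variable [IsAlgClosed k] [CharZero k] [Fintype ι]
variable (hG₁ : IsConnectedReductive G₁) (hT₁ : IsMaximalTorusIn T₁ G₁)
  (hG₂ : IsConnectedReductive G₂) (hT₂ : IsMaximalTorusIn T₂ G₂)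
  (h₁ : IsRootDatumOf G₁ T₁ P eX₁ eY₁) (h₂ : IsRootDatumOf G₂ T₂ P eX₂ eY₂)

/-! ### Surjectivity of the projections -/

include hG₁ in
/-- **`p₁(D) = 𝔤₁`**: every `A ∈ Lie(G₁)` is the first component of an element of `D`.
[cite: Humphreys1972, 14.2] -/
theorem exists_mem_fst_eq {y : Y} (hy : ∀ i, P.root' i y ≠ 0) {A : Matrix n₁ n₁ k} (hA : A ∈ lieAlgebraGL G₁) :
    ∃ d ∈ graphSubalgebra hT₁ hT₂ h₁ h₂ y, d.1 = A := by
  rw [← mem_fstSubmodule_iff]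
  have hle : lieAlgebraGL T₁ ⊔ ⨆ γ : ι, lieWeightSpace G₁ T₁ (charOfWeight eX₁ (P.root γ)) ≤
      fstSubmodule (hT₁ := hT₁) (hT₂ := hT₂) (h₁ := h₁) (h₂ := h₂) y := by
    refine sup_le (fun H hH => ?_) (iSup_le fun γ => fun B hB => ?_)
    · exact (mem_fstSubmodule_iff).2 (exists_mem_fst_eq_of_mem_lieAlgebraGL y hH)
    · obtain ⟨c, rfl⟩ := (h₁.mem_lieWeightSpace_root_iff hG₁ hT₁ γ).1 hB
      exact Submodule.smul_mem _ c ((mem_fstSubmodule_iff).2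
        (exists_mem_fst_eq_rootE (hG₁ := hG₁) (hT₁ := hT₁) (hT₂ := hT₂) (h₁ := h₁) (h₂ := h₂) hy γ))
  exact hle (lieAlgebraGL_le_torus_sup_roots h₁ hG₁ hT₁ hA)

include hG₂ in
/-- **`p₂(D) = 𝔤₂`.** [cite: Humphreys1972, 14.2] -/
theorem exists_mem_snd_eq {y : Y} (hy : ∀ i, P.root' i y ≠ 0) {B : Matrix n₂ n₂ k} (hB : B ∈ lieAlgebraGL G₂) :
    ∃ d ∈ graphSubalgebra hT₁ hT₂ h₁ h₂ y, d.2 = B := by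
  rw [← mem_sndSubmodule_iff]
  have hle : lieAlgebraGL T₂ ⊔ ⨆ γ : ι, lieWeightSpace G₂ T₂ (charOfWeight eX₂ (P.root γ)) ≤
      sndSubmodule (hT₁ := hT₁) (hT₂ := hT₂) (h₁ := h₁) (h₂ := h₂) y := by
    refine sup_le (fun H hH => ?_) (iSup_le fun γ => fun B hB => ?_)
    · exact (mem_sndSubmodule_iff).2 (exists_mem_snd_eq_of_mem_lieAlgebraGL y hH)
    · obtain ⟨c, rfl⟩ := (h₂.mem_lieWeightSpace_root_iff hG₂ hT₂ γ).1 hB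
      exact Submodule.smul_mem _ c ((mem_sndSubmodule_iff).2
        (exists_mem_snd_eq_rootE (hG₂ := hG₂) (hT₁ := hT₁) (hT₂ := hT₂) (h₁ := h₁) (h₂ := h₂) hy γ))
  exact hle (lieAlgebraGL_le_torus_sup_roots h₂ hG₂ hT₂ hB)

/-! ### The isomorphism `ψ` -/

include hG₁ in
/-- For `A ∈ 𝔤₁` there is `B ∈ 𝔤₂` with `(A, B) ∈ D`. [cite: Humphreys1972, 14.2] -/
theorem exists_pair_mem {y : Y} (hy : ∀ i, P.root' i y ≠ 0) (A : ↥(lieAlgebraGL G₁)) :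
    ∃ B : ↥(lieAlgebraGL G₂), (((A : Matrix n₁ n₁ k), (B : Matrix n₂ n₂ k)) : Matrix n₁ n₁ k × Matrix n₂ n₂ k) ∈
      graphSubalgebra hT₁ hT₂ h₁ h₂ y := by
  obtain ⟨d, hd, hd1⟩ := exists_mem_fst_eq hG₁ hT₁ hT₂ h₁ h₂ hy A.2
  refine ⟨⟨d.2, (mem_lieAlgebraGL_of_mem hd).2⟩, ?_⟩
  have : d = ((A : Matrix n₁ n₁ k), d.2) := Prod.ext hd1 rfl
  rwa [this] at hd

/-- The function underlying `ψ`. [folklore] -/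
def psiFun {y : Y} (hy : ∀ i, P.root' i y ≠ 0) (A : ↥(lieAlgebraGL G₁)) : ↥(lieAlgebraGL G₂) :=
  (exists_pair_mem hG₁ hT₁ hT₂ h₁ h₂ hy A).choose

/-- The graph property of `psiFun`. [folklore] -/
lemma psiFun_mem {y : Y} (hy : ∀ i, P.root' i y ≠ 0) (A : ↥(lieAlgebraGL G₁)) :
    (((A : Matrix n₁ n₁ k), (psiFun hG₁ hT₁ hT₂ h₁ h₂ hy A : Matrix n₂ n₂ k)) : Matrix n₁ n₁ k × Matrix n₂ n₂ k) ∈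
      graphSubalgebra hT₁ hT₂ h₁ h₂ y :=
  (exists_pair_mem hG₁ hT₁ hT₂ h₁ h₂ hy A).choose_spec

include hG₂ in
/-- Uniqueness: `(A, B) ∈ D ⇒ B = psiFun A`. [folklore] -/
lemma psiFun_eq_of_mem {y : Y} (hy : ∀ i, P.root' i y ≠ 0) {A : ↥(lieAlgebraGL G₁)} {B : Matrix n₂ n₂ k}
    (hB : (((A : Matrix n₁ n₁ k), B) : Matrix n₁ n₁ k × Matrix n₂ n₂ k) ∈ graphSubalgebra hT₁ hT₂ h₁ h₂ y) :
    (psiFun hG₁ hT₁ hT₂ h₁ h₂ hy A : Matrix n₂ n₂ k) = B := by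
  have h := eq_of_fst_eq hG₁ hT₁ hG₂ hT₂ h₁ h₂ hy (psiFun_mem hG₁ hT₁ hT₂ h₁ h₂ hy A) hB rfl
  exact congrArg Prod.snd h

/-- `ψ` as a linear map. [folklore] -/
def psiLin {y : Y} (hy : ∀ i, P.root' i y ≠ 0) : ↥(lieAlgebraGL G₁) →ₗ[k] ↥(lieAlgebraGL G₂) where
  toFun := psiFun hG₁ hT₁ hT₂ h₁ h₂ hy
  map_add' A A' := by
    apply Subtype.ext
    rw [Submodule.coe_add]
    refine psiFun_eq_of_mem hG₁ hT₁ hG₂ hT₂ h₁ h₂ hy ?_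
    have h := (graphSubalgebra hT₁ hT₂ h₁ h₂ y).add_mem (psiFun_mem hG₁ hT₁ hT₂ h₁ h₂ hy A)
      (psiFun_mem hG₁ hT₁ hT₂ h₁ h₂ hy A')
    rwa [Prod.mk_add_mk] at h
  map_smul' c A := by
    apply Subtype.ext
    rw [RingHom.id_apply, Submodule.coe_smul]
    refine psiFun_eq_of_mem hG₁ hT₁ hG₂ hT₂ h₁ h₂ hy ?_
    have h := (graphSubalgebra hT₁ hT₂ h₁ h₂ y).smul_mem c (psiFun_mem hG₁ hT₁ hT₂ h₁ h₂ hy A)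
    rwa [Prod.smul_mk] at h

include hG₁ hG₂ in
/-- `psiLin` is bijective. [cite: Humphreys1972, 14.2] -/
theorem psiLin_bijective {y : Y} (hy : ∀ i, P.root' i y ≠ 0) :
    Function.Bijective (psiLin hG₁ hT₁ hG₂ hT₂ h₁ h₂ hy) := by
  constructor
  · intro A A' hAA'
    have hA := psiFun_mem hG₁ hT₁ hT₂ h₁ h₂ hy A
    have hA' := psiFun_mem hG₁ hT₁ hT₂ h₁ h₂ hy A'
    have e : (psiFun hG₁ hT₁ hT₂ h₁ h₂ hy A : Matrix n₂ n₂ k) = psiFun hG₁ hT₁ hT₂ h₁ h₂ hy A' :=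
      congrArg Subtype.val hAA'
    rw [e] at hA
    exact Subtype.ext (congrArg Prod.fst (eq_of_snd_eq hG₁ hT₁ hG₂ hT₂ h₁ h₂ hy hA hA' rfl))
  · intro B
    obtain ⟨d, hd, hd2⟩ := exists_mem_snd_eq hT₁ hG₂ hT₂ h₁ h₂ hy B.2
    refine ⟨⟨d.1, (mem_lieAlgebraGL_of_mem hd).1⟩, Subtype.ext ?_⟩
    change (psiFun hG₁ hT₁ hT₂ h₁ h₂ hy ⟨d.1, _⟩ : Matrix n₂ n₂ k) = B
    rw [← hd2]
    exact psiFun_eq_of_mem hG₁ hT₁ hG₂ hT₂ h₁ h₂ hy (A := ⟨d.1, _⟩) (by simpa using hd)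

/-- **The linear isomorphism `ψ : Lie(G₁) ≅ Lie(G₂)` whose graph is `D`.** [cite: Humphreys1972, 14.2] -/
def psi {y : Y} (hy : ∀ i, P.root' i y ≠ 0) : ↥(lieAlgebraGL G₁) ≃ₗ[k] ↥(lieAlgebraGL G₂) :=
  LinearEquiv.ofBijective (psiLin hG₁ hT₁ hG₂ hT₂ h₁ h₂ hy) (psiLin_bijective hG₁ hT₁ hG₂ hT₂ h₁ h₂ hy)


/-- **Graph property**: `(A, ψ A) ∈ D`. [cite: Humphreys1972, 14.2] -/
theorem mem_graph_psi {y : Y} (hy : ∀ i, P.root' i y ≠ 0) (A : ↥(lieAlgebraGL G₁)) :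
    (((A : Matrix n₁ n₁ k), (psi hG₁ hT₁ hG₂ hT₂ h₁ h₂ hy A : Matrix n₂ n₂ k)) : Matrix n₁ n₁ k × Matrix n₂ n₂ k) ∈
      graphSubalgebra hT₁ hT₂ h₁ h₂ y :=
  psiFun_mem hG₁ hT₁ hT₂ h₁ h₂ hy A

/-- **Uniqueness**: `(A, B) ∈ D ⇒ ψ A = B`. [cite: Humphreys1972, 14.2] -/
theorem psi_eq_of_mem {y : Y} (hy : ∀ i, P.root' i y ≠ 0) {A : ↥(lieAlgebraGL G₁)} {B : Matrix n₂ n₂ k}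
    (hB : (((A : Matrix n₁ n₁ k), B) : Matrix n₁ n₁ k × Matrix n₂ n₂ k) ∈ graphSubalgebra hT₁ hT₂ h₁ h₂ y) :
    (psi hG₁ hT₁ hG₂ hT₂ h₁ h₂ hy A : Matrix n₂ n₂ k) = B :=
  psiFun_eq_of_mem hG₁ hT₁ hG₂ hT₂ h₁ h₂ hy hB

/-- Graph property of `ψ⁻¹`: `(ψ⁻¹ B, B) ∈ D`. [cite: Humphreys1972, 14.2] -/
theorem mem_graph_psi_symm {y : Y} (hy : ∀ i, P.root' i y ≠ 0) (B : ↥(lieAlgebraGL G₂)) :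
    ((((psi hG₁ hT₁ hG₂ hT₂ h₁ h₂ hy).symm B : Matrix n₁ n₁ k), (B : Matrix n₂ n₂ k)) : Matrix n₁ n₁ k × Matrix n₂ n₂ k) ∈
      graphSubalgebra hT₁ hT₂ h₁ h₂ y := by
  have h := mem_graph_psi hG₁ hT₁ hG₂ hT₂ h₁ h₂ hy ((psi hG₁ hT₁ hG₂ hT₂ h₁ h₂ hy).symm B)
  rwa [LinearEquiv.apply_symm_apply] at h

/-- Uniqueness for `ψ⁻¹`: `(A, B) ∈ D ⇒ ψ⁻¹ B = A`. [cite: Humphreys1972, 14.2] -/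
theorem psi_symm_eq_of_mem {y : Y} (hy : ∀ i, P.root' i y ≠ 0) {A : Matrix n₁ n₁ k} {B : ↥(lieAlgebraGL G₂)}
    (hA : ((A, (B : Matrix n₂ n₂ k)) : Matrix n₁ n₁ k × Matrix n₂ n₂ k) ∈ graphSubalgebra hT₁ hT₂ h₁ h₂ y) :
    ((psi hG₁ hT₁ hG₂ hT₂ h₁ h₂ hy).symm B : Matrix n₁ n₁ k) = A :=
  congrArg Prod.fst (eq_of_snd_eq hG₁ hT₁ hG₂ hT₂ h₁ h₂ hy (mem_graph_psi_symm hG₁ hT₁ hG₂ hT₂ h₁ h₂ hy B) hA rfl)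

/-- **`ψ` is a homomorphism of Lie algebras**: `ψ [A, A'] = [ψ A, ψ A']`. [cite: Humphreys1972, 14.2] -/
theorem psi_lie {y : Y} (hy : ∀ i, P.root' i y ≠ 0) (A A' : ↥(lieAlgebraGL G₁)) :
    (psi hG₁ hT₁ hG₂ hT₂ h₁ h₂ hy ⟨(A : Matrix n₁ n₁ k) * A' - A' * A, lie_mem_lieAlgebraGL A.2 A'.2⟩ : Matrix n₂ n₂ k) =
      (psi hG₁ hT₁ hG₂ hT₂ h₁ h₂ hy A : Matrix n₂ n₂ k) * psi hG₁ hT₁ hG₂ hT₂ h₁ h₂ hy A' -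
        (psi hG₁ hT₁ hG₂ hT₂ h₁ h₂ hy A' : Matrix n₂ n₂ k) * psi hG₁ hT₁ hG₂ hT₂ h₁ h₂ hy A := by
  apply psi_eq_of_mem
  have h := (graphSubalgebra hT₁ hT₂ h₁ h₂ y).lie_mem (mem_graph_psi hG₁ hT₁ hG₂ hT₂ h₁ h₂ hy A) (mem_graph_psi hG₁ hT₁ hG₂ hT₂ h₁ h₂ hy A')
  rwa [bracket_eq] at h

/-- **`ψ|Lie(T₁) = θ`.** [cite: Humphreys1972, 14.2] -/
theorem psi_torus {y : Y} (hy : ∀ i, P.root' i y ≠ 0) (H : ↥(lieAlgebraGL T₁)) :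
    (psi hG₁ hT₁ hG₂ hT₂ h₁ h₂ hy ⟨H, lieAlgebraGL_mono hT₁.1 H.2⟩ : Matrix n₂ n₂ k) =
      ((theta eX₁ eX₂ hT₁.2.1 hT₂.2.1 H : ↥(lieAlgebraGL T₂)) : Matrix n₂ n₂ k) :=
  psi_eq_of_mem hG₁ hT₁ hG₂ hT₂ h₁ h₂ hy (graph_mem y H)

/-- `ψ` maps `Lie(T₁)` into `Lie(T₂)`. [folklore] -/
theorem psi_mem_lieAlgebraGL_torus {y : Y} (hy : ∀ i, P.root' i y ≠ 0) {H : ↥(lieAlgebraGL G₁)}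
    (hH : (H : Matrix n₁ n₁ k) ∈ lieAlgebraGL T₁) :
    (psi hG₁ hT₁ hG₂ hT₂ h₁ h₂ hy H : Matrix n₂ n₂ k) ∈ lieAlgebraGL T₂ := by
  have h := psi_torus hG₁ hT₁ hG₂ hT₂ h₁ h₂ hy ⟨H, hH⟩
  have e : (⟨((⟨H, hH⟩ : ↥(lieAlgebraGL T₁)) : Matrix n₁ n₁ k), lieAlgebraGL_mono hT₁.1 hH⟩ : ↥(lieAlgebraGL G₁)) = H :=
    Subtype.ext rfl
  rw [e] at h
  rw [h]
  exact (theta eX₁ eX₂ hT₁.2.1 hT₂.2.1 ⟨H, hH⟩).2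

/-- **`ψ (h¹_γ) = h²_γ`.** [cite: Humphreys1972, 14.2] -/
theorem psi_rootH {y : Y} (hy : ∀ i, P.root' i y ≠ 0) (γ : ι) :
    (psi hG₁ hT₁ hG₂ hT₂ h₁ h₂ hy ⟨h₁.rootH γ, h₁.rootH_mem_lieAlgebraGL' γ⟩ : Matrix n₂ n₂ k) = h₂.rootH γ :=
  psi_eq_of_mem hG₁ hT₁ hG₂ hT₂ h₁ h₂ hy (rootH_pair_mem y γ)

/-- **`ψ (e¹_i) = e²_i` for simple `i`.** [cite: Humphreys1972, 14.2] -/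
theorem psi_rootE {y : Y} (hy : ∀ i, P.root' i y ≠ 0) {i : ι} (hi : i ∈ simpleRoots P y) :
    (psi hG₁ hT₁ hG₂ hT₂ h₁ h₂ hy ⟨h₁.rootE i, (h₁.rootE_mem i).1⟩ : Matrix n₂ n₂ k) = h₂.rootE i := by
  haveI : Infinite k := IsAlgClosed.instInfinite
  exact psi_eq_of_mem hG₁ hT₁ hG₂ hT₂ h₁ h₂ hy (rootE_pair_mem hi)

/-- **`ψ (f¹_i) = f²_i` for simple `i`.** [cite: Humphreys1972, 14.2] -/
theorem psi_rootF {y : Y} (hy : ∀ i, P.root' i y ≠ 0) {i : ι} (hi : i ∈ simpleRoots P y) :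
    (psi hG₁ hT₁ hG₂ hT₂ h₁ h₂ hy ⟨h₁.rootF i, (h₁.rootF_mem i).1⟩ : Matrix n₂ n₂ k) = h₂.rootF i := by
  haveI : Infinite k := IsAlgClosed.instInfinite
  exact psi_eq_of_mem hG₁ hT₁ hG₂ hT₂ h₁ h₂ hy (rootF_pair_mem hi)

/-- **Equivariance**: `ψ (t A t⁻¹) = f_T(t) ψ(A) f_T(t)⁻¹` for `t ∈ T₁`. [cite: Humphreys1972, 14.2] -/
theorem psi_conj {y : Y} (hy : ∀ i, P.root' i y ≠ 0) (t : ↥T₁) (A : ↥(lieAlgebraGL G₁)) :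
    (psi hG₁ hT₁ hG₂ hT₂ h₁ h₂ hy ⟨((t : ↥T₁) : GL n₁ k) * (A : Matrix n₁ n₁ k) * ((((t : ↥T₁) : GL n₁ k))⁻¹ : GL n₁ k),
        conj_mem_lieAlgebraGL (hT₁.1 t.2) A.2⟩ : Matrix n₂ n₂ k) =
      (((torusIso eX₁ eX₂ hT₁.2.1 hT₂.2.1 t : ↥T₂) : GL n₂ k) : Matrix n₂ n₂ k) * psi hG₁ hT₁ hG₂ hT₂ h₁ h₂ hy A *
        (((((torusIso eX₁ eX₂ hT₁.2.1 hT₂.2.1 t : ↥T₂) : GL n₂ k))⁻¹ : GL n₂ k) : Matrix n₂ n₂ k) := by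
  apply psi_eq_of_mem
  have h := sigma_mem_graphSubalgebra y t (mem_graph_psi hG₁ hT₁ hG₂ hT₂ h₁ h₂ hy A)
  rwa [sigma_apply] at h

/-- **`ψ (𝔤₁_x) ⊆ 𝔤₂_x`** for every weight `x`. [cite: Humphreys1972, 14.2] -/
theorem psi_mem_lieWeightSpace {y : Y} (hy : ∀ i, P.root' i y ≠ 0) {x : X} {A : ↥(lieAlgebraGL G₁)}
    (hA : (A : Matrix n₁ n₁ k) ∈ lieWeightSpace G₁ T₁ (charOfWeight eX₁ x)) :
    (psi hG₁ hT₁ hG₂ hT₂ h₁ h₂ hy A : Matrix n₂ n₂ k) ∈ lieWeightSpace G₂ T₂ (charOfWeight eX₂ x) := by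
  refine ⟨(psi hG₁ hT₁ hG₂ hT₂ h₁ h₂ hy A).2, fun t₂ => ?_⟩
  set t : ↥T₁ := (torusIso eX₁ eX₂ hT₁.2.1 hT₂.2.1).symm t₂ with ht
  have ht₂ : torusIso eX₁ eX₂ hT₁.2.1 hT₂.2.1 t = t₂ := MulEquiv.apply_symm_apply _ _
  have hconj := psi_conj hG₁ hT₁ hG₂ hT₂ h₁ h₂ hy t A
  rw [ht₂] at hconj
  -- `t A t⁻¹ = χ¹_x(t) A`
  have hA' : ((t : ↥T₁) : GL n₁ k) * (A : Matrix n₁ n₁ k) * ((((t : ↥T₁) : GL n₁ k))⁻¹ : GL n₁ k) =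
      ((charOfWeight eX₁ x t : kˣ) : k) • (A : Matrix n₁ n₁ k) := by
    rw [Matrix.coe_units_inv]; exact hA.2 t
  have hsm : (psi hG₁ hT₁ hG₂ hT₂ h₁ h₂ hy ⟨((t : ↥T₁) : GL n₁ k) * (A : Matrix n₁ n₁ k) * ((((t : ↥T₁) : GL n₁ k))⁻¹ : GL n₁ k),
        conj_mem_lieAlgebraGL (hT₁.1 t.2) A.2⟩ : Matrix n₂ n₂ k) =
      ((charOfWeight eX₁ x t : kˣ) : k) • (psi hG₁ hT₁ hG₂ hT₂ h₁ h₂ hy A : Matrix n₂ n₂ k) := by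
    have e : (⟨((t : ↥T₁) : GL n₁ k) * (A : Matrix n₁ n₁ k) * ((((t : ↥T₁) : GL n₁ k))⁻¹ : GL n₁ k),
        conj_mem_lieAlgebraGL (hT₁.1 t.2) A.2⟩ : ↥(lieAlgebraGL G₁)) = ((charOfWeight eX₁ x t : kˣ) : k) • A :=
      Subtype.ext hA'
    rw [e, map_smul, Submodule.coe_smul]
  rw [hsm, ← charOfWeight_torusIso hT₁.2.1 hT₂.2.1 x t, ht₂] at hconj
  rw [← Matrix.coe_units_inv]
  exact hconj.symm

end Iso

end LieGraph

end Literature.NumberTheory.Automorphic
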